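import Literature.Analysis.FunctionSpaces.BesselJWeberSchafheitlin
import Literature.Analysis.FunctionSpaces.LiebWuIntegrals
import HarnessLib

/-!
# Discharged fact: the Lieb–Wu charge gap vanishes at `U = 0`

`Literature.Analysis.FunctionSpaces.LiebWuIntegrals` records as a named fact
(`Literature.Hubbard.liebWuChargeGap_zero : Prop`) that the closed form of the Lieb–Wu charge gap of the
half-filled Hubbard chain,
`Δ(U) = μ₊ - μ₋ = U - 4 + 8 ∫₀^∞ J₁(ω) / (ω (1 + e^{ωU/2})) dω`
(Lieb–Wu, PRL 20 (1968) 1445, eq. (22)), vanishes at `U = 0`. This file proves it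
(`Literature.Analysis.FunctionSpaces.liebWuChargeGap_zero_holds`).

Lieb–Wu (*The one-dimensional Hubbard model: a reminiscence*, Physica A 321 (2003) 1–27 =
arXiv:cond-mat/0207529, §7 "Absence of a Mott transition") print `μ₊ + μ₋ = U`,
`μ₋(U) = 2 - 4 ∫₀^∞ J₁(ω) / (ω [1 + exp(ωU/2)]) dω` and
`μ₋(0) = 2 - 2 ∫₀^∞ J₁(ω)/ω dω = 0`, referring to Gradshteyn–Ryzhik for the last integral; the
original announcement is Lieb–Wu, PRL 20 (1968) 1445, discussion after eq. (22). Since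
`Δ = μ₊ - μ₋ = U - 2 μ₋(U)`, the vendored `Δ(U)` is exactly `U - 2 μ₋(U)` and the fact is the
statement `μ₋(0) = 0` of the source.

## Proof

At `U = 0` the integrand of `Δ` is `J₁(ω) / (ω (1 + e⁰)) = (1/2) · J₁(ω)/ω`, and
`∫₀^∞ J₁(ω)/ω dω = 1` is the Weber–Schafheitlin-type integral proved (via Fourier inversion for
the semicircle law) as `Literature.Analysis.FunctionSpaces.integral_Ioi_besselJ_one_div` in
`Literature.Analysis.FunctionSpaces.BesselJWeberSchafheitlin` (DLMF 10.22.43 at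
`(μ, ν) = (-1, 1)`). Hence `Δ(0) = 0 - 4 + 8 · (1/2) · 1 = 0`.

## References

* E. H. Lieb, F. Y. Wu, *Absence of Mott transition in an exact solution of the short-range,
  one-band model in one dimension*, Phys. Rev. Lett. 20 (1968) 1445–1448, eq. (22) and the
  discussion after it.
* E. H. Lieb, F. Y. Wu, *The one-dimensional Hubbard model: a reminiscence*, Physica A 321 (2003)
  1–27, arXiv:cond-mat/0207529, §7 (displayed formulas for `μ₊ + μ₋`, `μ₋(U)` and `μ₋(0) = 0`).
* NIST DLMF 10.22.43.
-/

open MeasureTheory Set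

namespace Literature.Analysis.FunctionSpaces

section Hubbard

/-- **Discharge of `Literature.Analysis.FunctionSpaces.liebWuChargeGap_zero`**: at `U = 0` the Lieb–Wu charge gap
`Δ(U) = U - 4 + 8 ∫₀^∞ J₁(ω) / (ω (1 + e^{ωU/2})) dω` vanishes, because the integrand becomes
`(1/2) · J₁(ω)/ω` and `∫₀^∞ J₁(ω)/ω dω = 1` (`Literature.Analysis.FunctionSpaces.integral_Ioi_besselJ_one_div`), so
`Δ(0) = -4 + 8 · (1/2) · 1 = 0`. This is `μ₊ - μ₋ = U - 2 μ₋(U)` at `U = 0` together with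
`μ₋(0) = 2 - 2 ∫₀^∞ J₁(ω)/ω dω = 0` (Lieb–Wu, Physica A 321 (2003) 1 = arXiv:cond-mat/0207529, §7
"Absence of a Mott transition", displayed formulas for `μ₊ + μ₋ = U`, `μ₋(U)` and `μ₋(0)`; Lieb–Wu,
PRL 20 (1968) 1445, discussion after eq. (22)).
[cite: LiebWuPRL1968, discussion after eq. (22); LiebWuPhysicaA2003, §7, formula for μ₋(0)] -/
theorem liebWuChargeGap_zero_holds : liebWuChargeGap_zero := by
  unfold liebWuChargeGap_zero
  rw [liebWuChargeGap_eq]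
  have h : ∀ ω : ℝ,
      besselJ 1 ω / (ω * (1 + Real.exp (ω * 0 / 2))) = 1 / 2 * (besselJ 1 ω / ω) := by
    intro ω
    simp only [mul_zero, zero_div, Real.exp_zero]
    ring
  simp_rw [h, integral_const_mul, integral_Ioi_besselJ_one_div]
  norm_num

end Hubbard

end Literature.Analysis.FunctionSpaces
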